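import Summits.CriticalPhenomena.SAWScalingLimit.Theorems.SAWLeftRightFKGFKGToTraversalBoundSlitNecklacePieces
import HarnessLib

/-!
# Vocabulary of line `slit-necklace`, part 3 (reshape r4): far tips of a piece, the far-tip witness, the slot law

Crux `SAWLeftRightFKG.FKGToTraversalBound` (stmt-CriticalPhenomena-1878), line `slit-necklace`, lead
prover-line-stmt-CriticalPhenomena-1878-c5-0, chart `Cruxes/FKGToTraversalBound/Lines/slit-necklace-chart-r4.md`.

Why reshape r4.  The r3 assembly (chart r2, step P2) resamples a whole piece `γ(i+1) … γ(j-1)` in its hung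
carrier and union-bounds over the SLOTS `(γ[0, i+1], γ[j-1, end])` of "the `J`-th far piece"; after the
disintegration each slot is charged the engine's `ε₁`, so the bound is `ε₁ · E[#pieces between the (J-1)-th and the
J-th far piece]` — and near a DEEP endpoint the chord returns to the blob `Ka` (a lattice segment of `ι/δ` sites
from `a_δ` to the boundary layer) `≍ (ι/δ)^{1/3}` times, so that expectation diverges along the deep-endpoint
approximations the line exists for.  Repair: cut the `J`-th piece that reaches FAR territory
(`η ≤ dist(·, ca)` and `η ≤ dist(·, cb)`) at its FIRST and LAST far indices `τ ≤ τ'` (`IsFarTipPiece`).  The slot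
`(γ[0, τ], γ[τ', end])` is then CANONICAL (determined by `γ` and `J`: the prefix carries exactly `J` earlier
far-tip pieces, ends with a near run and one far vertex), the slots of distinct exteriors are disjoint events of
total mass `≤ 1`, and the middle `γ[τ, τ']` given the exterior is the critical chord of the doubly-slit hung
carrier `D_δ ∖ (spine ∪ γ[0, τ-1] ∪ γ[τ'+1, end])` between the two far tips (`necklace_beadIdentity`, p126690, with
`u := γ τ`, `u' := γ τ'`), an r2 carrier with both endpoints trace-adjacent (`stub_hungPresentation`, p127603).
The engine (`UniformSubshellTight`) applies to it UNCONDITIONALLY; the static allowance it needs is a route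
between the two far TIPS avoiding the spine and the exterior of the piece (`HasFarTipWitness`) — the r4 form of
the necklace witness (`NecklaceWitnessFar`), whose route may hug the piece's own near stubs for free.

Contents (namespace `…Theorems.FKGToTraversalBound.SlitNecklace`): the predicates `IsFarTipPiece`,
`HasFarTipWitness`, small API, and the two HYPOTHESIS NAMES of the r4 stubs `SlotLaw` (probabilistic core:
hung presentation + engine ⇒ the far-tip slot bound) and `NecklaceWitnessFar` (deterministic planar topology).
Definitions and closed API lemmas only; no literature fact; nothing restates the crux.
-/

noncomputable section

open MeasureTheory Filter Topology Set Metric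
open scoped NNReal ENNReal
open Literature.Probability.LatticeModels
open Literature.Probability.RandomPlanarGeometry
open Literature.Probability.RandomPlanarGeometry.SAW
open Summit.CriticalPhenomena.SAWScalingLimit.Theorems.FKGToTraversalBound.Negative (dom)

namespace Summit.CriticalPhenomena.SAWScalingLimit.Theorems.FKGToTraversalBound.SlitNecklace

section FarTip

variable {V : Type*} {G : SimpleGraph V} {u v : V} {E : Type*} [PseudoMetricSpace E]

/-- A vertex is FAR (for the marked centres `ca`, `cb` and the reach `η`) when it is at distance `≥ η` from both
centres; NEAR otherwise. [folklore] -/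
def IsFarPt (z ca cb : E) (η : ℝ) : Prop :=
  η ≤ dist z ca ∧ η ≤ dist z cb

/-- **Far-tip piece.**  `(i, j)` is a piece of `p` off the spine `Sp` and `τ ≤ τ'` are its FIRST and LAST far
indices: `i < τ`, `τ' < j`, the vertices at `τ` and `τ'` are far, and every interior index before `τ` or after
`τ'` carries a near vertex.  The sub-walks `p(i+1) … p(τ)` and `p(τ') … p(j-1)` are the near STUBS of the
piece, `p(τ) … p(τ')` its MIDDLE. [folklore] -/
def IsFarTipPiece (emb : V → E) (p : G.Walk u v) (Sp : Set V) (i j τ τ' : ℕ) (ca cb : E) (η : ℝ) : Prop :=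
  IsPiece p Sp i j ∧ i < τ ∧ τ ≤ τ' ∧ τ' < j ∧
    IsFarPt (emb (p.getVert τ)) ca cb η ∧ IsFarPt (emb (p.getVert τ')) ca cb η ∧
    (∀ n, i < n → n < τ → ¬ IsFarPt (emb (p.getVert n)) ca cb η) ∧
    (∀ n, τ' < n → n < j → ¬ IsFarPt (emb (p.getVert n)) ca cb η)

/-- A far-tip piece is a far piece (for every defect set). [folklore] -/
theorem IsFarTipPiece.isFarPiece {emb : V → E} {p : G.Walk u v} {Sp : Set V} (S : Set V) {i j τ τ' : ℕ}
    {ca cb : E} {η : ℝ} (h : IsFarTipPiece emb p Sp i j τ τ' ca cb η) :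
    IsFarPiece emb p Sp S i j ca cb η :=
  ⟨h.1, Or.inr (Or.inr ⟨τ, h.2.1, h.2.2.1.trans_lt h.2.2.2.1, h.2.2.2.2.1.1, h.2.2.2.2.1.2⟩)⟩

/-- The far tips of a piece are unique. [folklore] -/
theorem IsFarTipPiece.tips_unique {emb : V → E} {p : G.Walk u v} {Sp : Set V} {i j τ₁ τ₁' τ₂ τ₂' : ℕ}
    {ca cb : E} {η : ℝ} (h₁ : IsFarTipPiece emb p Sp i j τ₁ τ₁' ca cb η)
    (h₂ : IsFarTipPiece emb p Sp i j τ₂ τ₂' ca cb η) : τ₁ = τ₂ ∧ τ₁' = τ₂' := by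
  obtain ⟨-, hi₁, hle₁, hj₁, hf₁, hf₁', hn₁, hn₁'⟩ := h₁
  obtain ⟨-, hi₂, hle₂, hj₂, hf₂, hf₂', hn₂, hn₂'⟩ := h₂
  constructor
  · by_contra hne
    rcases lt_or_gt_of_ne hne with hlt | hlt
    · exact hn₂ τ₁ hi₁ hlt hf₁
    · exact hn₁ τ₂ hi₂ hlt hf₂
  · by_contra hne
    rcases lt_or_gt_of_ne hne with hlt | hlt
    · exact hn₁' τ₂' hlt hj₂ hf₂'
    · exact hn₂' τ₁' hlt hj₁ hf₁'

/-- A piece with a far interior vertex has far tips. [folklore] -/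
theorem exists_isFarTipPiece {emb : V → E} {p : G.Walk u v} {Sp : Set V} {i j : ℕ} {ca cb : E} {η : ℝ}
    (h : IsPiece p Sp i j) (hfar : ∃ n, i < n ∧ n < j ∧ IsFarPt (emb (p.getVert n)) ca cb η) :
    ∃ τ τ', IsFarTipPiece emb p Sp i j τ τ' ca cb η := by
  classical
  -- first far index
  have hex : ∃ n, i < n ∧ n < j ∧ IsFarPt (emb (p.getVert n)) ca cb η := hfar
  let τ := Nat.find hex
  have hτ : i < τ ∧ τ < j ∧ IsFarPt (emb (p.getVert τ)) ca cb η := Nat.find_spec hex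
  have hτmin : ∀ n, n < τ → ¬ (i < n ∧ n < j ∧ IsFarPt (emb (p.getVert n)) ca cb η) := fun n hn =>
    Nat.find_min hex hn
  -- last far index, as `j - 1 - (first far index counted from the right)`
  have hex' : ∃ m, ∃ n, n = j - 1 - m ∧ i < n ∧ n < j ∧ IsFarPt (emb (p.getVert n)) ca cb η :=
    ⟨j - 1 - τ, τ, by omega, hτ.1, hτ.2.1, hτ.2.2⟩
  let m := Nat.find hex'
  obtain ⟨τ', hτ'eq, hτ'i, hτ'j, hτ'f⟩ : ∃ n, n = j - 1 - m ∧ i < n ∧ n < j ∧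
      IsFarPt (emb (p.getVert n)) ca cb η := Nat.find_spec hex'
  have hmmin : ∀ m', m' < m → ¬ ∃ n, n = j - 1 - m' ∧ i < n ∧ n < j ∧ IsFarPt (emb (p.getVert n)) ca cb η :=
    fun m' hm' => Nat.find_min hex' hm'
  refine ⟨τ, τ', h, hτ.1, ?_, hτ'j, hτ.2.2, hτ'f, ?_, ?_⟩
  · by_contra hlt
    exact hτmin τ' (not_le.1 hlt) ⟨hτ'i, hτ'j, hτ'f⟩
  · intro n hin hnτ hf
    exact hτmin n hnτ ⟨hin, hnτ.trans hτ.2.1, hf⟩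
  · intro n hτ'n hnj hf
    have hm' : j - 1 - n < m := by omega
    exact hmmin (j - 1 - n) hm' ⟨n, by omega, by omega, hnj, hf⟩

end FarTip

/-! ## The far-tip witness and the two r4 stubs, as HYPOTHESIS NAMES -/

/-- **Far-tip witness with `k`-bounded windows.**  For a chord `p` of `Ω_δ`, a spine `Sp` and indices
`τ ≤ τ' ≤ |p|`: some SELF-AVOIDING route `Q` of `Ω_δ` from `p(τ)` to `p(τ')` avoids the spine and every vertex
of `p` of index `< τ` or `> τ'` (so `Q` is a chord of the doubly-slit hung carrier of the middle `p(τ) … p(τ')`,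
whose own vertices are free for `Q`) and does NOT have `k` strictly separated index windows across
`D(y; σ₁, σ₂)`.  This is the static allowance the engine `UniformSubshellTight` consumes for that carrier.
[folklore] -/
def HasFarTipWitness (Ω : Set ℂ) (δ : ℝ) (Sp : Set (Site 2)) {a₀ b₀ : Site 2}
    (p : (discreteDomainGraph Ω δ).Walk a₀ b₀) (τ τ' k : ℕ) (y : ℂ) (σ₁ σ₂ : ℝ) : Prop :=
  τ ≤ τ' ∧ τ' ≤ p.length ∧
    ∃ Q : (discreteDomainGraph Ω δ).Walk (p.getVert τ) (p.getVert τ'),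
      Q.IsPath ∧
      (∀ z ∈ Q.support, z ∉ Sp ∧ ∀ m, m ≤ p.length → (m < τ ∨ τ' < m) → z ≠ p.getVert m) ∧
      ¬ HasSepWindows (meshPoint δ) Q k 0 Q.length y σ₁ σ₂

/-- Monotonicity of the far-tip witness in the window budget. [folklore] -/
theorem HasFarTipWitness.mono {Ω : Set ℂ} {δ : ℝ} {Sp : Set (Site 2)} {a₀ b₀ : Site 2}
    {p : (discreteDomainGraph Ω δ).Walk a₀ b₀} {τ τ' k k' : ℕ} {y : ℂ} {σ₁ σ₂ : ℝ}
    (h : HasFarTipWitness Ω δ Sp p τ τ' k y σ₁ σ₂) (hk : k ≤ k') : HasFarTipWitness Ω δ Sp p τ τ' k' y σ₁ σ₂ := by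
  obtain ⟨h₁, h₂, Q, hQ, havoid, hwin⟩ := h
  exact ⟨h₁, h₂, Q, hQ, havoid, fun hw => hwin (hw.of_le hk)⟩

/-- **SLOT LAW** (reshape r4, probabilistic core of the necklace assembly; provable now from the landed
`necklace_beadIdentity` p126690, `stub_hungPresentation` p127603, the window dictionary p115507/p129943/p130875 and
the two hypotheses).  Given the hung presentation and the engine: for every `ε > 0` and allowance `n₀` there is a
threshold `n` such that for every tame-presented domain `D_δ ∖ S = (dom C δ)_δ` with attached spine
`Ka ∪ Kb ∪ S`, chord endpoints `a₀ ∈ Ka`, `b₀ ∈ Kb`, every shell `D(y; ρ, R)` with `δ ≤ ρ`, `2ρ ≤ R`, all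
far/near parameters `ca cb η`, every `J` and every window shell `D(y; s₁, s₂)` at least one mesh inside the
engine's sub-shell `D(y; (3ρ+R)/4, (ρ+3R)/4)`, the critical chord's `J`-th FAR-TIP piece (the far-tip piece with
exactly `J` far-tip pieces starting before it) has, with probability `≤ ε`, BOTH `n` strictly separated windows
across `D(y; ρ, R)` between its far tips AND a far-tip witness with fewer than `n₀ + 1` windows across
`D(y; s₁, s₂)`.  (Canonical slot ⇒ disjoint decomposition of total mass `≤ 1`; bead identity ⇒ the middle is the
chord of the doubly-slit hung carrier; hung presentation ⇒ that carrier is r2 with both tips trace-adjacent;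
engine with allowance `2 n₀ + 1` and the witness as `γ₀`: fewer than `n₀ + 1` index windows across `D(y; s₁, s₂)`
means fewer than `2 (n₀ + 1)` polyline traversals of the one-mesh-wider sub-shell,
`ShellIteration.exists_sepIndexTraversals_of_hasTraversals_toCurve`; `n` index windows give `n` traversals,
`hasTraversals_of_hasSepWindows`.)
(HYPOTHESIS NAME of the line — a definition used as a stub conclusion/hypothesis, not a literature fact.) -/
def SlotLaw : Prop :=
  HungPresentation → UniformSubshellTight →
    ∀ ε : ℝ, 0 < ε → ∀ n₀ : ℕ, ∃ n : ℕ,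
      ∀ (D : DobrushinDomain) (δ : ℝ) (c : Site 2) (C : (zdGraph 2).Walk c c) (S Ka Kb : Finset (Site 2))
        (a₀ b₀ : Site 2) (ca cb : ℂ) (η : ℝ) (y : ℂ) (ρ R s₁ s₂ : ℝ) (J : ℕ),
        0 < δ →
        (∀ x' y' : Site 2, (discreteDomainGraph (dom C δ) δ).Adj x' y' ↔
          ((discreteDomainGraph D.carrier δ).Adj x' y' ∧ x' ∉ S ∧ y' ∉ S)) →
        (∀ k ∈ Ka ∪ Kb ∪ S, ∃ (q : Site 2) (w : (zdGraph 2).Walk k q), q ∈ C.support ∧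
          ∀ z ∈ w.support, z ∈ Ka ∪ Kb ∪ S ∨ z ∈ C.support) →
        a₀ ∈ Ka → b₀ ∈ Kb → δ ≤ ρ → 2 * ρ ≤ R →
        (3 * ρ + R) / 4 + δ ≤ s₁ → s₁ < s₂ → s₂ ≤ (ρ + 3 * R) / 4 - δ →
        law D.carrier δ a₀ b₀
            {γ | ∃ i j τ τ' : ℕ,
              IsFarTipPiece (meshPoint δ) γ.walk (↑(Ka ∪ Kb ∪ S)) i j τ τ' ca cb η ∧
              {i' : ℕ | i' < i ∧ ∃ j' τ₁ τ₁', IsFarTipPiece (meshPoint δ) γ.walk (↑(Ka ∪ Kb ∪ S)) i' j' τ₁ τ₁' ca cb η}.ncard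
                  = J ∧
              HasSepWindows (meshPoint δ) γ.walk n τ τ' y ρ R ∧
              HasFarTipWitness D.carrier δ (↑(Ka ∪ Kb ∪ S)) γ.walk τ τ' (n₀ + 1) y s₁ s₂} ≤
          ENNReal.ofReal ε

/-- **NECKLACE WITNESS, FAR-TIP FORM** (reshape r4 of `NecklaceWitness`; deterministic planar topology — the
line's own hard lemma).  Fix a Dobrushin domain and a genuine shell `D(y; σ₁, σ₂)`; there is a boundary budget
`nB` such that for all small meshes, every tame presentation `(C, S)` of `D_δ`, attached spine `Ka ∪ Kb ∪ S`
(blobs within `ιa, ιb` of marked centres `ca, cb`, `ιa + 3δ ≤ η`, `ιb + 3δ ≤ η`, `2η + δ < |ca - cb|`, the band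
of the shell `2η`-far from both centres, `4δ < σ₂ - σ₁`) and every self-avoiding chord `γ` of `D_δ` from `Ka` to
`Kb`: the far pieces of `γ` carry a RANK of height `≤ #far pieces`, and every far-tip piece `(i, j; τ, τ')` whose
LOWER-rank far pieces have at most `W` windows across the `2δ`-thinner shell admits a far-tip witness (route in
`D_δ` from `γ τ` to `γ τ'` avoiding the spine and `γ` outside `[τ, τ']`) with fewer than
`8 (#far + #S + 2)² (W + nB + 2)` strictly separated windows across `D(y; σ₁, σ₂)`.  Route: one of the two
outline arcs, from tip to tip, of the face of the arrangement (domain boundary, spine, near pieces, the piece's own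
near stubs, the other far pieces) that contains the middle — the inner arc for a loop (hugging blob layer, near
pieces, stubs and CHILD loops), the child-face arc of the crosscut dual tree for a piece joining two spine
components (hugging lower crosscuts, loops of that face, boundary layer); cost: along such an arc the hugged
obstacles occur in an `abab`-free order (planarity: two disjoint connected obstacles cannot alternate twice along a
simple route keeping them on one side), so there are `≤ 2·(#obstacles)` hugging runs, each costing `≤ W` (a lower far
piece, traced monotonically within `√2 δ`), `≤ nB + O(1)` (the boundary layer: traversals of the thinner shell by
the Jordan curve `∂D`, finite, plus the passages over the near complexes) or `0` (near territory,
`B(ca, 2η) ∪ B(cb, 2η)` misses the band).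
(HYPOTHESIS NAME of the line — a definition used as a stub conclusion/hypothesis, not a literature fact; OPEN as a
formalisation task, believed true; a failure would be `stub-misstated` with a corrected cost polynomial, which the
assembly absorbs unchanged.) -/
def NecklaceWitnessFar : Prop :=
  ∀ (D : DobrushinDomain) (y : ℂ) (σ₁ σ₂ : ℝ), 0 < σ₁ → σ₁ < σ₂ → ∃ nB : ℕ, ∀ᶠ δ in 𝓝[>] (0 : ℝ),
    ∀ (c : Site 2) (C : (zdGraph 2).Walk c c) (S Ka Kb : Finset (Site 2)) (a₀ b₀ : Site 2) (ca cb : ℂ) (ιa ιb η : ℝ)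
      (γ : (discreteDomainGraph D.carrier δ).Walk a₀ b₀),
      (∀ x' y' : Site 2, (discreteDomainGraph (dom C δ) δ).Adj x' y' ↔
        ((discreteDomainGraph D.carrier δ).Adj x' y' ∧ x' ∉ S ∧ y' ∉ S)) →
      (∀ k ∈ Ka ∪ Kb ∪ S, ∃ (q : Site 2) (w : (zdGraph 2).Walk k q), q ∈ C.support ∧
        ∀ z ∈ w.support, z ∈ Ka ∪ Kb ∪ S ∨ z ∈ C.support) →
      γ.IsPath → a₀ ∈ Ka → b₀ ∈ Kb →
      (∀ k ∈ Ka, dist (meshPoint δ k) ca ≤ ιa) → (∀ k ∈ Kb, dist (meshPoint δ k) cb ≤ ιb) →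
      ιa + 3 * δ ≤ η → ιb + 3 * δ ≤ η → 2 * η + δ < dist ca cb → 4 * δ < σ₂ - σ₁ →
      (∀ z : ℂ, σ₁ ≤ dist z y → dist z y ≤ σ₂ → 2 * η ≤ dist z ca ∧ 2 * η ≤ dist z cb) →
      ∃ rk : ℕ → ℕ,
        (∀ i, rk i ≤ {i' : ℕ | ∃ j', IsFarPiece (meshPoint δ) γ (↑(Ka ∪ Kb ∪ S)) (↑S) i' j' ca cb η}.ncard) ∧
        ∀ (i j τ τ' W : ℕ), IsFarTipPiece (meshPoint δ) γ (↑(Ka ∪ Kb ∪ S)) i j τ τ' ca cb η →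
          (∀ i' j', IsFarPiece (meshPoint δ) γ (↑(Ka ∪ Kb ∪ S)) (↑S) i' j' ca cb η → rk i' < rk i →
            ¬ HasSepWindows (meshPoint δ) γ (W + 1) (i' + 1) (j' - 1) y (σ₁ + 2 * δ) (σ₂ - 2 * δ)) →
          HasFarTipWitness D.carrier δ (↑(Ka ∪ Kb ∪ S)) γ τ τ'
            (8 * ({i' : ℕ | ∃ j', IsFarPiece (meshPoint δ) γ (↑(Ka ∪ Kb ∪ S)) (↑S) i' j' ca cb η}.ncard
                  + S.card + 2) ^ 2 * (W + nB + 2))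
            y σ₁ σ₂

/-- **Registered glue (r4): a far-tip piece is a far piece**, so the far-tip pieces the slot law resamples are
among the `< 2N₀ + 2g` far pieces counted by `NecklaceBookkeeping`, and a far piece carrying a window across a shell
whose band is far from both centres has far tips (`exists_isFarTipPiece`). [folklore] -/
theorem isFarPiece_of_isFarTipPiece :
    ∀ {V E : Type*} [PseudoMetricSpace E] {G : SimpleGraph V} {u v : V} (emb : V → E) (p : G.Walk u v)
      (Sp S : Set V) (i j τ τ' : ℕ) (ca cb : E) (η : ℝ),
      IsFarTipPiece emb p Sp i j τ τ' ca cb η → IsFarPiece emb p Sp S i j ca cb η :=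
  fun _ _ _ S _ _ _ _ _ _ _ h => h.isFarPiece S

end Summit.CriticalPhenomena.SAWScalingLimit.Theorems.FKGToTraversalBound.SlitNecklace

end
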